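import Literature.Analysis.FluidPDE.NewtonPotential
import Literature.Analysis.FluidPDE.KochTataruKernelFourier
import Literature.Analysis.FluidPDE.OseenHeat
import Literature.Analysis.FluidPDE.SchefferTestFunction
import Literature.Analysis.FluidPDE.CaloricPotentialContinuity
import HarnessLib

/-!
# The heat flow of the truncated Newtonian kernel: Duhamel representation and the `L¹` bound
# for its third derivatives

Analysis/FluidPDE support file for the discharge of the named fact
`Literature.Analysis.FluidPDE.NSBoundedInteriorContinuity` (`NSBoundedInteriorRegularity.lean`;
Seregin–Šverák 2009, §2). In the duality proof the pressure is eliminated through the test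
function `φ₂ 𝒰[Γ₀ ⋆ ∂_c g]`, `Γ₀ = θΓ` the truncated Newtonian kernel of `NewtonKernel.lean`
(`newtonNear r₀ r₁`, `ΔΓ₀ = δ₀ - λ`, `λ = newtonFarLaplacian r₀ r₁`), and the velocity then appears
integrated against the third spatial derivatives `∂ᵤ∂ᵥ∂_w e^{aΔ}Γ₀ = heatD3 a u v w Γ₀` of the heat
flow of `Γ₀`. Continuity of the resulting potential needs the **integrable singularity**
`‖heatD3 a u v w Γ₀‖_{L¹} ≤ C (1 + a^{-1/2})` as `a → 0⁺` (the generic bound for `L¹` data is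
`a^{-3/2}`): the third derivatives of `e^{aΔ}Γ = Δ⁻¹G_a` form the Oseen tensor, whose `L¹` norm is
`O(a^{-1/2})` (Koch–Tataru 2001, (14); Lemarié-Rieusset 2016, §6.2). This file proves it, in
dimension three and without Fourier analysis:

* `heatExtension_newtonNear_eq_neg_integral_Ioi` — **Duhamel representation of `e^{aΔ}Γ₀`**:
  `e^{aΔ}Γ₀(x) = -∫_a^∞ (G_s(x) - e^{sΔ}λ(x)) ds` for `a > 0` (the caloric extension solves
  `∂ₐ e^{aΔ}Γ₀ = Δe^{aΔ}Γ₀ = G_a - e^{aΔ}λ` by Green's representation formula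
  `∫ Γ₀ Δφ = φ(0) - ∫ λφ` of `NewtonPotential.lean`, and tends to `0` as `a → ∞`);
* `heatD3_newtonNear_eq_neg_integral_Ioi` — the same for the third derivatives,
  `heatD3 a u v w Γ₀ (x) = -∫_a^∞ (D³G_s(x)[u, v, w] - heatD3 s u v w λ (x)) ds`
  (derivatives are passed under the time integral through the semigroup law: `heatD3 a` is the
  composite of three layers `heatD1 (a/6)` acting on `e^{(a/2)Δ}Γ₀`, and each layer is an integral
  operator with integrable kernel, `heatD1_setIntegral_comm`);
* `exists_lintegral_enorm_heatD3_newtonNear_le` — **the `L¹` bound**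
  `∫ |heatD3 a u v w Γ₀| ≤ C (1 + a^{-1/2})`, `C = C(r₀, r₁, u, v, w)`: the Gaussian part is the
  Oseen–Koch–Tataru kernel (`inner_oseenKernel_eq`: `∫_a^∞ D³G_s ds = ⟪K(a)[u,w], v⟫ - ∂ᵤG_a⟪w,v⟫`,
  `∫‖K(a, z)‖ dz ≤ C a^{-1/2}`, `‖∂ᵤG_a‖₁ ≤ C a^{-1/2}`), and the `λ` part is bounded uniformly
  (`‖heatD3 s u v w λ‖₁ ≤ min (‖∂ᵤ∂ᵥ∂_wλ‖₁, 216 s^{-3/2}‖λ‖₁)`).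

Also proved, in every dimension: the commutation of `heatD1` with dominated set integrals of a
parametrised family (`heatD1_setIntegral_comm`) and its propagation along layers, linearity of
`heatD1`/`heatD3` in the data, `heatD3 b u v w G_s = D³G_{s+b}`, `heatD3 b u v w (e^{sΔ}λ) =
heatD3 (s + b) u v w λ`, and `heatD3 s u v w λ = e^{sΔ}(∂ᵤ∂ᵥ∂_wλ)` for smooth compactly supported
`λ`.

## References

* H. Koch, D. Tataru, Adv. Math. 157 (2001), §2 (5)–(8), §3 (14). [`KochTataruAdvMath2001`]
* P. G. Lemarié-Rieusset, *The Navier–Stokes problem in the 21st century* (2016), §6.2 (the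
  Oseen tensor `(1/√t)³ O(x/√t)`, `O ∼ |x|^{-3}`). [`LemarieRieusset2016`]
* D. Gilbarg, N. Trudinger, *Elliptic PDE of second order*, (2.16)–(2.17). [`GilbargTrudinger2001`]
-/

noncomputable section

open MeasureTheory Set Function Filter Metric Real
open scoped ENNReal NNReal Topology RealInnerProductSpace Convolution Laplacian

namespace Literature.Analysis.FluidPDE

section General

variable {E : Type*} [NormedAddCommGroup E] [InnerProductSpace ℝ E] [FiniteDimensional ℝ E]
  [MeasurableSpace E] [BorelSpace E]

/-! ### Linearity of `heatD1`, `heatD3` in the data -/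

/-- `heatD1 a v φ x = ∫ ∂ᵥG_a(y) φ(x - y) dy` for `φ ∈ Lᵖ`. [folklore] -/
theorem heatD1_eq_integral {φ : E → ℝ} {p : ℝ≥0∞} (hφ : MemLp φ p volume) (hp : 1 ≤ p)
    {a : ℝ} (ha : 0 < a) (v x : E) :
    heatD1 a v φ x = ∫ y, fderiv ℝ (UnboundedOperators.heatKernel a) y v * φ (x - y) := by
  rw [heatD1_eq_convolution hφ hp ha v, convolution_def]
  rfl

/-- `heatD1` is additive in the data (`Lᵖ` data). [folklore] -/
theorem heatD1_sub {φ ψ : E → ℝ} {p : ℝ≥0∞} (hφ : MemLp φ p volume) (hψ : MemLp ψ p volume)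
    (hp : 1 ≤ p) {a : ℝ} (ha : 0 < a) (v : E) :
    heatD1 a v (φ - ψ) = heatD1 a v φ - heatD1 a v ψ := by
  funext x
  rw [Pi.sub_apply]
  haveI : p.HolderConjugate (ENNReal.conjExponent p) := .conjExponent hp
  have hK : MemLp (fun z => fderiv ℝ (UnboundedOperators.heatKernel (E := E) a) z v)
      (ENNReal.conjExponent p) volume :=
    UnboundedOperators.memLp_fderiv_heatKernel_apply ha v _
  have h1 : Integrable (fun y => fderiv ℝ (UnboundedOperators.heatKernel a) y v * φ (x - y)) :=
    UnboundedOperators.convolutionExistsAt_of_memLp (ContinuousLinearMap.lsmul ℝ ℝ) hK hφ x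
  have h2 : Integrable (fun y => fderiv ℝ (UnboundedOperators.heatKernel a) y v * ψ (x - y)) :=
    UnboundedOperators.convolutionExistsAt_of_memLp (ContinuousLinearMap.lsmul ℝ ℝ) hK hψ x
  rw [heatD1_eq_integral (hφ.sub hψ) hp ha, heatD1_eq_integral hφ hp ha, heatD1_eq_integral hψ hp ha,
    ← integral_sub h1 h2]
  congr 1; funext y; rw [Pi.sub_apply]; ring

/-- `heatD3` is additive in the data (`Lᵖ` data). [folklore] -/
theorem heatD3_sub {φ ψ : E → ℝ} {p : ℝ≥0∞} (hφ : MemLp φ p volume) (hψ : MemLp ψ p volume)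
    (hp : 1 ≤ p) {a : ℝ} (ha : 0 < a) (u v w : E) (x : E) :
    heatD3 a u v w (φ - ψ) x = heatD3 a u v w φ x - heatD3 a u v w ψ x := by
  have h3 : 0 < a / 3 := by positivity
  have hsplit : a = a / 3 + a / 3 + a / 3 := by ring
  rw [hsplit, heatD3_eq_heatD1_heatD1_heatD1 (hφ.sub hψ) hp h3 h3 h3,
    heatD3_eq_heatD1_heatD1_heatD1 hφ hp h3 h3 h3, heatD3_eq_heatD1_heatD1_heatD1 hψ hp h3 h3 h3]
  rw [heatD1_sub hφ hψ hp h3 w,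
    heatD1_sub (memLp_heatD1 hφ hp h3 w) (memLp_heatD1 hψ hp h3 w) hp h3 v,
    heatD1_sub (memLp_heatD1 (memLp_heatD1 hφ hp h3 w) hp h3 v)
      (memLp_heatD1 (memLp_heatD1 hψ hp h3 w) hp h3 v) hp h3 u, Pi.sub_apply]

/-! ### `heatD1` commutes with dominated set integrals of a family -/

/-- **A dominated measurable family.** `k : ℝ → E → ℝ` on the measurable parameter set `S`:
jointly a.e. strongly measurable on `S × E`, every slice measurable, and `|k s y| ≤ m(s)` with
`m` integrable on `S`. [folklore] -/
structure IsDominatedFamily (S : Set ℝ) (k : ℝ → E → ℝ) (m : ℝ → ℝ) : Prop where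
  /-- the parameter set is measurable -/
  measurableSet : MeasurableSet S
  /-- joint measurability on `S × E` -/
  aestronglyMeasurable : AEStronglyMeasurable (uncurry k) ((volume.restrict S).prod volume)
  /-- every slice is measurable -/
  slice : ∀ s ∈ S, AEStronglyMeasurable (k s) volume
  /-- domination by an integrable function of the parameter -/
  bound : ∀ s ∈ S, ∀ y, |k s y| ≤ m s
  /-- integrability of the dominating function -/
  integrable : IntegrableOn m S volume

variable {S : Set ℝ} {k : ℝ → E → ℝ} {m : ℝ → ℝ}

/-- The dominating function is nonnegative on `S`. [folklore] -/
theorem IsDominatedFamily.nonneg (h : IsDominatedFamily S k m) {s : ℝ} (hs : s ∈ S) : 0 ≤ m s :=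
  (abs_nonneg _).trans (h.bound s hs 0)

/-- The slices of a dominated family are in `L^∞`. [folklore] -/
theorem IsDominatedFamily.memLp_top (h : IsDominatedFamily S k m) {s : ℝ} (hs : s ∈ S) :
    MemLp (k s) ∞ volume :=
  memLp_top_of_bound (h.slice s hs) (m s) (Eventually.of_forall fun y => by
    rw [Real.norm_eq_abs]; exact h.bound s hs y)

/-- The integrated function `y ↦ ∫_S k s y ds` of a dominated family is bounded by `∫_S m`.
[folklore] -/
theorem IsDominatedFamily.norm_integral_le (h : IsDominatedFamily S k m) (y : E) :
    ‖∫ s in S, k s y‖ ≤ ∫ s in S, m s := by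
  refine norm_integral_le_of_norm_le h.integrable ?_
  refine (ae_restrict_iff' h.measurableSet).2 (Eventually.of_forall fun s hs => ?_)
  rw [Real.norm_eq_abs]; exact h.bound s hs y

/-- The integrated function of a dominated family is measurable. [folklore] -/
theorem IsDominatedFamily.aestronglyMeasurable_integral (h : IsDominatedFamily S k m) :
    AEStronglyMeasurable (fun y => ∫ s in S, k s y) (volume : Measure E) :=
  h.aestronglyMeasurable.prod_swap.integral_prod_right'

/-- The integrated function of a dominated family is in `L^∞`. [folklore] -/
theorem IsDominatedFamily.memLp_top_integral (h : IsDominatedFamily S k m) :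
    MemLp (fun y => ∫ s in S, k s y) ∞ (volume : Measure E) :=
  memLp_top_of_bound h.aestronglyMeasurable_integral (∫ s in S, m s)
    (Eventually.of_forall h.norm_integral_le)

/-- **`heatD1` commutes with dominated set integrals**: for a dominated family `k` on `S` and
`c > 0`, `∂ᵤ e^{cΔ} (∫_S k s ds) (x) = ∫_S ∂ᵤ e^{cΔ}(k s)(x) ds` (the layer `heatD1 c u` is the
integral operator with the integrable kernel `∂ᵤG_c`; Fubini). [folklore] -/
theorem heatD1_setIntegral_comm (h : IsDominatedFamily S k m) {c : ℝ} (hc : 0 < c) (u x : E) :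
    heatD1 c u (fun y => ∫ s in S, k s y) x = ∫ s in S, heatD1 c u (k s) x := by
  set G : E → ℝ := fun y => fderiv ℝ (UnboundedOperators.heatKernel c) y u with hG
  have hGint : Integrable G := UnboundedOperators.integrable_fderiv_heatKernel_apply hc u
  rw [heatD1_eq_integral h.memLp_top_integral le_top hc]
  have hslice : ∀ s ∈ S, heatD1 c u (k s) x = ∫ y, G y * k s (x - y) := fun s hs =>
    heatD1_eq_integral (h.memLp_top hs) le_top hc u x
  rw [setIntegral_congr_fun h.measurableSet hslice]
  -- the double integrand `G y * k s (x - y)` is integrable on `E × S`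
  have hF : Integrable (fun q : E × ℝ => G q.1 * k q.2 (x - q.1))
      ((volume : Measure E).prod (volume.restrict S)) := by
    have hm : AEStronglyMeasurable (fun q : E × ℝ => G q.1 * k q.2 (x - q.1))
        ((volume : Measure E).prod (volume.restrict S)) := by
      refine (hGint.aestronglyMeasurable.comp_fst).mul ?_
      -- `(y, s) ↦ k s (x - y)` from joint measurability and the measure-preserving reflection
      have hmp : MeasurePreserving (fun q : E × ℝ => ((q.2, x - q.1) : ℝ × E))
          ((volume : Measure E).prod (volume.restrict S)) ((volume.restrict S).prod volume) := by
        have h1 : MeasurePreserving (Prod.swap : E × ℝ → ℝ × E)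
            ((volume : Measure E).prod (volume.restrict S)) ((volume.restrict S).prod volume) :=
          Measure.measurePreserving_swap
        have h2 : MeasurePreserving (fun q : ℝ × E => ((q.1, x - q.2) : ℝ × E))
            ((volume.restrict S).prod volume) ((volume.restrict S).prod volume) :=
          (MeasurePreserving.id _).prod (Measure.measurePreserving_sub_left volume x)
        exact h2.comp h1
      exact h.aestronglyMeasurable.comp_measurePreserving hmp
    have hmem : ∀ᵐ q ∂((volume : Measure E).prod (volume.restrict S)), q.2 ∈ S := by
      have heq : (volume : Measure E).prod (volume.restrict S) =
          ((volume : Measure E).prod volume).restrict (univ ×ˢ S) := by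
        rw [← Measure.prod_restrict, Measure.restrict_univ]
      rw [heq]
      filter_upwards [ae_restrict_mem (MeasurableSet.univ.prod h.measurableSet)] with q hq
      exact hq.2
    refine (hGint.norm.mul_prod h.integrable.norm).mono' hm ?_
    filter_upwards [hmem] with q hq
    rw [norm_mul]
    refine mul_le_mul_of_nonneg_left ?_ (norm_nonneg _)
    rw [Real.norm_eq_abs, Real.norm_eq_abs]
    exact (h.bound q.2 hq _).trans (le_abs_self _)
  calc ∫ y, G y * ∫ s in S, k s (x - y)
      = ∫ y, ∫ s in S, G y * k s (x - y) := by
        congr 1; funext y; rw [integral_const_mul]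
    _ = ∫ s in S, ∫ y, G y * k s (x - y) := integral_integral_swap hF

/-- **Layers propagate domination**: if `k` is a dominated family on `S`, so is
`s ↦ ∂ᵤe^{cΔ}(k s)`, with the dominating function multiplied by `‖∂ᵤG_c‖₁ ≤ 2^{d/2}c^{-1/2}‖u‖`.
[folklore] -/
theorem IsDominatedFamily.heatD1 (h : IsDominatedFamily S k m) {c : ℝ} (hc : 0 < c) (u : E) :
    IsDominatedFamily S (fun s => heatD1 c u (k s))
      (fun s => (2 : ℝ) ^ ((Module.finrank ℝ E : ℝ) / 2) * c ^ (-(1 / 2) : ℝ) * ‖u‖ * m s) where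
  measurableSet := h.measurableSet
  aestronglyMeasurable := by
    have hgp : ∀ᵐ s ∂(volume.restrict S), 0 < c ∧ MemLp (fun y => uncurry k (s, y)) ∞ volume :=
      (ae_restrict_iff' h.measurableSet).2 (Eventually.of_forall fun s hs => ⟨hc, h.memLp_top hs⟩)
    exact aestronglyMeasurable_heatD1_param (μ := volume.restrict S) (c := fun _ : ℝ => c)
      measurable_const h.aestronglyMeasurable le_top hgp u
  slice s hs := (contDiff_heatD1 (h.memLp_top hs) le_top hc u (n := 0)).continuous.aestronglyMeasurable
  bound s hs y := by
    rw [← Real.norm_eq_abs]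
    exact norm_heatD1_le_of_bound (h.memLp_top hs) le_top
      (fun z => by rw [Real.norm_eq_abs]; exact h.bound s hs z) hc u y
  integrable := h.integrable.const_mul _

/-- **`heatD3` commutes with dominated set integrals** (three layers of
`heatD1_setIntegral_comm` at the clock `b/3`). [folklore] -/
theorem heatD3_setIntegral_comm (h : IsDominatedFamily S k m) {b : ℝ} (hb : 0 < b)
    (u v w x : E) :
    heatD3 b u v w (fun y => ∫ s in S, k s y) x = ∫ s in S, heatD3 b u v w (k s) x := by
  have h3 : 0 < b / 3 := by positivity
  have hsplit : b = b / 3 + b / 3 + b / 3 := by ring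
  rw [hsplit, heatD3_eq_heatD1_heatD1_heatD1 h.memLp_top_integral le_top h3 h3 h3]
  have h₁ := h.heatD1 h3 w
  have h₂ := h₁.heatD1 h3 v
  have e1 : heatD1 (b / 3) w (fun y => ∫ s in S, k s y) =
      fun y => ∫ s in S, heatD1 (b / 3) w (k s) y :=
    funext fun y => heatD1_setIntegral_comm h h3 w y
  rw [e1]
  have e2 : heatD1 (b / 3) v (fun y => ∫ s in S, heatD1 (b / 3) w (k s) y) =
      fun y => ∫ s in S, heatD1 (b / 3) v (heatD1 (b / 3) w (k s)) y :=
    funext fun y => heatD1_setIntegral_comm h₁ h3 v y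
  rw [e2, heatD1_setIntegral_comm h₂ h3 u x]
  refine setIntegral_congr_fun h.measurableSet fun s hs => ?_
  rw [heatD3_eq_heatD1_heatD1_heatD1 (h.memLp_top hs) le_top h3 h3 h3]

/-- A family continuous on `(0, ∞) × E`, restricted to `S ⊆ (0, ∞)`, is jointly a.e. strongly
measurable on `S × E`. [folklore] -/
theorem aestronglyMeasurable_uncurry_restrict_of_continuousOn {k : ℝ → E → ℝ} {S : Set ℝ}
    (hS : MeasurableSet S) (hS0 : S ⊆ Ioi 0)
    (hk : ContinuousOn (fun q : ℝ × E => k q.1 q.2) (Ioi 0 ×ˢ univ)) :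
    AEStronglyMeasurable (uncurry k) ((volume.restrict S).prod (volume : Measure E)) := by
  have hc : ContinuousOn (uncurry k) (S ×ˢ univ) := hk.mono (prod_mono hS0 Subset.rfl)
  have hmeas : MeasurableSet (S ×ˢ (univ : Set E)) := hS.prod MeasurableSet.univ
  have h := hc.aestronglyMeasurable (μ := (volume : Measure ℝ).prod (volume : Measure E)) hmeas
  rw [← Measure.prod_restrict, Measure.restrict_univ] at h
  exact h

/-! ### `heatD3` of the heat kernel and of caloric extensions -/

/-- `e^{bΔ}G_s = G_{b+s}` as functions (semigroup law of the kernels). [folklore] -/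
theorem heatExtension_heatKernel_eq {s b : ℝ} (hs : 0 < s) (hb : 0 < b) :
    UnboundedOperators.heatExtension (UnboundedOperators.heatKernel (E := E) s) b =
      UnboundedOperators.heatKernel (b + s) :=
  UnboundedOperators.heatKernel_convolution_heatKernel_holds hb hs

/-- **`heatD3` of the heat kernel is the iterated third derivative**:
`heatD3 b u v w G_s (x) = D³G_{b+s}(x)[u, v, w]`. [folklore] -/
theorem heatD3_heatKernel {s b : ℝ} (hs : 0 < s) (hb : 0 < b) (u v w x : E) :
    heatD3 b u v w (UnboundedOperators.heatKernel s) x =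
      iteratedFDeriv ℝ 3 (UnboundedOperators.heatKernel (b + s)) x ![u, v, w] := by
  unfold heatD3
  rw [heatExtension_heatKernel_eq hs hb,
    iteratedFDeriv_three_apply (FunctionSpaces.contDiff_heatKernel' (b + s)) x u v w]

/-- **`heatD3` after a caloric extension**: `heatD3 b u v w (e^{sΔ}φ) = heatD3 (s + b) u v w φ`
(`Lᵖ` data). [folklore] -/
theorem heatD3_heatExtension {φ : E → ℝ} {p : ℝ≥0∞} (hφ : MemLp φ p volume) (hp : 1 ≤ p)
    {s b : ℝ} (hs : 0 < s) (hb : 0 < b) (u v w x : E) :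
    heatD3 b u v w (UnboundedOperators.heatExtension φ s) x = heatD3 (s + b) u v w φ x := by
  unfold heatD3
  rw [UnboundedOperators.heatExtension_add_holds hφ hp hs hb]

/-- A smooth compactly supported function and its directional derivatives are in `L¹`.
[folklore] -/
theorem memLp_one_of_contDiff_hasCompactSupport {g : E → ℝ} (hg : ContDiff ℝ ((⊤ : ℕ∞) : WithTop ℕ∞) g)
    (hgc : HasCompactSupport g) : MemLp g 1 (volume : Measure E) :=
  hg.continuous.memLp_of_hasCompactSupport hgc

omit [FiniteDimensional ℝ E] [MeasurableSpace E] [BorelSpace E] in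
/-- The directional derivative of a smooth compactly supported function is smooth and compactly
supported. [folklore] -/
theorem contDiff_hasCompactSupport_fderiv_apply {g : E → ℝ} (hg : ContDiff ℝ ((⊤ : ℕ∞) : WithTop ℕ∞) g)
    (hgc : HasCompactSupport g) (w : E) :
    ContDiff ℝ ((⊤ : ℕ∞) : WithTop ℕ∞) (fun z => fderiv ℝ g z w) ∧ HasCompactSupport (fun z => fderiv ℝ g z w) :=
  ⟨(hg.fderiv_right (m := ((⊤ : ℕ∞) : WithTop ℕ∞)) (by exact_mod_cast le_top)).clm_apply
      contDiff_const,
    hgc.fderiv_apply ℝ w⟩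

/-- **Derivatives fall on smooth compactly supported data**:
`heatD3 s u v w λ = e^{sΔ}(∂ᵤ∂ᵥ∂_wλ)` for `λ ∈ C_c^∞`. [folklore] -/
theorem heatD3_eq_heatExtension_fderiv3 {g : E → ℝ} (hg : ContDiff ℝ ((⊤ : ℕ∞) : WithTop ℕ∞) g)
    (hgc : HasCompactSupport g) {s : ℝ} (hs : 0 < s) (u v w : E) :
    heatD3 s u v w g = UnboundedOperators.heatExtension
      (fun y => fderiv ℝ (fun z => fderiv ℝ (fun z' => fderiv ℝ g z' w) z v) y u) s := by
  obtain ⟨hg₁, hg₁c⟩ := contDiff_hasCompactSupport_fderiv_apply hg hgc w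
  obtain ⟨hg₂, hg₂c⟩ := contDiff_hasCompactSupport_fderiv_apply hg₁ hg₁c v
  obtain ⟨hg₃, hg₃c⟩ := contDiff_hasCompactSupport_fderiv_apply hg₂ hg₂c u
  have m0 := memLp_one_of_contDiff_hasCompactSupport hg hgc
  have m1 := memLp_one_of_contDiff_hasCompactSupport hg₁ hg₁c
  have m2 := memLp_one_of_contDiff_hasCompactSupport hg₂ hg₂c
  have m3 := memLp_one_of_contDiff_hasCompactSupport hg₃ hg₃c
  have step1 : (fun y => fderiv ℝ (UnboundedOperators.heatExtension g s) y w) =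
      UnboundedOperators.heatExtension (fun z' => fderiv ℝ g z' w) s :=
    funext fun y => UnboundedOperators.fderiv_heatExtension_apply_eq_heatExtension_fderiv
      (hg.of_le (by exact_mod_cast le_top)) m0 le_rfl m1 le_rfl hs y
  have step2 : (fun z => fderiv ℝ (UnboundedOperators.heatExtension (fun z' => fderiv ℝ g z' w) s) z v) =
      UnboundedOperators.heatExtension (fun z => fderiv ℝ (fun z' => fderiv ℝ g z' w) z v) s :=
    funext fun y => UnboundedOperators.fderiv_heatExtension_apply_eq_heatExtension_fderiv
      (hg₁.of_le (by exact_mod_cast le_top)) m1 le_rfl m2 le_rfl hs y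
  have step3 : (fun y => fderiv ℝ (UnboundedOperators.heatExtension
      (fun z => fderiv ℝ (fun z' => fderiv ℝ g z' w) z v) s) y u) =
      UnboundedOperators.heatExtension
        (fun y => fderiv ℝ (fun z => fderiv ℝ (fun z' => fderiv ℝ g z' w) z v) y u) s :=
    funext fun y => UnboundedOperators.fderiv_heatExtension_apply_eq_heatExtension_fderiv
      (hg₂.of_le (by exact_mod_cast le_top)) m2 le_rfl m3 le_rfl hs y
  unfold heatD3
  rw [step1, step2, step3]

/-- **Uniform `L¹` bound for `heatD3` of smooth compactly supported data**:
`‖heatD3 s u v w λ‖₁ ≤ ‖∂ᵤ∂ᵥ∂_wλ‖₁`. [folklore] -/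
theorem eLpNorm_heatD3_le_of_contDiff {g : E → ℝ} (hg : ContDiff ℝ ((⊤ : ℕ∞) : WithTop ℕ∞) g)
    (hgc : HasCompactSupport g) {s : ℝ} (hs : 0 < s) (u v w : E) :
    eLpNorm (heatD3 s u v w g) 1 volume ≤
      eLpNorm (fun y => fderiv ℝ (fun z => fderiv ℝ (fun z' => fderiv ℝ g z' w) z v) y u) 1 volume := by
  rw [heatD3_eq_heatExtension_fderiv3 hg hgc hs u v w]
  obtain ⟨hg₁, hg₁c⟩ := contDiff_hasCompactSupport_fderiv_apply hg hgc w
  obtain ⟨hg₂, hg₂c⟩ := contDiff_hasCompactSupport_fderiv_apply hg₁ hg₁c v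
  obtain ⟨hg₃, hg₃c⟩ := contDiff_hasCompactSupport_fderiv_apply hg₂ hg₂c u
  exact UnboundedOperators.eLpNorm_heatExtension_le_holds
    (memLp_one_of_contDiff_hasCompactSupport hg₃ hg₃c) le_rfl hs

end General

/-! ### The truncated Newtonian kernel under the heat flow (dimension three) -/

section Newton

/-- Local notation for `ℝ³ = EuclideanSpace ℝ (Fin 3)`. -/
local notation "ℝ³" => EuclideanSpace ℝ (Fin 3)

variable {r₀ r₁ : ℝ}

/-- `dim ℝ³ = 3` (a private copy of a standard fact, to keep imports light). [folklore] -/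
private theorem finrank_R3' : Module.finrank ℝ ℝ³ = 3 := by simp

/-- `Γ₀ ∈ L¹(ℝ³)` as an `MemLp` statement. [folklore] -/
theorem memLp_one_newtonNear (h₀ : 0 < r₀) (h₁ : r₀ < r₁) : MemLp (newtonNear r₀ r₁) 1 volume :=
  (memLp_one_iff_integrable).2 (integrable_newtonNear h₀.le h₁)

/-- `λ = ΔΓ∞` is smooth and compactly supported, hence in `L¹`. [folklore] -/
theorem memLp_one_newtonFarLaplacian (h₀ : 0 < r₀) (h₁ : r₀ < r₁) :
    MemLp (newtonFarLaplacian r₀ r₁) 1 volume :=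
  memLp_one_of_contDiff_hasCompactSupport (contDiff_newtonFarLaplacian h₀ h₁)
    (hasCompactSupport_newtonFarLaplacian h₀.le h₁)

/-- **The Laplacian of `e^{sΔ}Γ₀`**: `Δ(e^{sΔ}Γ₀)(x) = G_s(x) - e^{sΔ}λ(x)` for `s > 0`, from
`Δ(e^{sΔ}Γ₀)(x) = ∫ Γ₀(y) Δ_y[G_s(x - ·)](y) dy` and Green's representation formula
`∫ Γ₀ Δφ = φ(0) - ∫ λ φ` (Gilbarg–Trudinger (2.16)–(2.17), localised; `NewtonPotential.lean`).
[cite: GilbargTrudinger2001, (2.16)–(2.17)] -/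
theorem laplacian_heatExtension_newtonNear (h₀ : 0 < r₀) (h₁ : r₀ < r₁) {s : ℝ} (hs : 0 < s)
    (x : ℝ³) :
    (Δ (UnboundedOperators.heatExtension (newtonNear r₀ r₁) s)) x =
      UnboundedOperators.heatKernel s x -
        UnboundedOperators.heatExtension (newtonFarLaplacian r₀ r₁) s x := by
  rw [UnboundedOperators.laplacian_heatExtension_eq_integral hs (memLp_one_newtonNear h₀ h₁) le_rfl x]
  -- the weight is the Laplacian of the reflected kernel
  set φ : ℝ³ → ℝ := fun y => UnboundedOperators.heatKernel s (x - y) with hφ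
  have hφC : ContDiff ℝ 2 φ :=
    (FunctionSpaces.contDiff_heatKernel' s).comp ((contDiff_const (c := x)).sub contDiff_id)
  have hΔφ : ∀ y, (Δ φ) y = (‖x - y‖ ^ 2 / (4 * s ^ 2) - (Module.finrank ℝ ℝ³ : ℝ) / (2 * s)) *
      UnboundedOperators.heatKernel s (x - y) := fun y => by
    rw [hφ, laplacian_comp_const_sub (UnboundedOperators.heatKernel s) x y, Scheffer.laplacian_heatKernel]
  have h1 : (∫ y, ((‖x - y‖ ^ 2 / (4 * s ^ 2) - (Module.finrank ℝ ℝ³ : ℝ) / (2 * s)) *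
      UnboundedOperators.heatKernel s (x - y)) • newtonNear r₀ r₁ y) =
      ∫ y, newtonNear r₀ r₁ y * (Δ φ) y := by
    congr 1; funext y; rw [hΔφ, smul_eq_mul, mul_comm]
  rw [h1, integral_newtonNear_mul_laplacian h₀ h₁ hφC]
  rw [hφ]
  simp only [sub_zero]
  rw [UnboundedOperators.heatExtension_eq_integral_sub]
  congr 1
  congr 1; funext y; rw [smul_eq_mul, mul_comm]

/-- The time integrand `s ↦ G_s(x) - e^{sΔ}λ(x)` is continuous on `(0, ∞)`. [folklore] -/
theorem continuousOn_heatKernel_sub_heatExtension (h₀ : 0 < r₀) (h₁ : r₀ < r₁) (x : ℝ³) :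
    ContinuousOn (fun s => UnboundedOperators.heatKernel s x -
      UnboundedOperators.heatExtension (newtonFarLaplacian r₀ r₁) s x) (Ioi 0) :=
  (continuousOn_heatKernel_time x).sub
    (UnboundedOperators.continuousOn_heatExtension_time (memLp_one_newtonFarLaplacian h₀ h₁) le_rfl x)

/-- Pointwise decay of the time integrand: `|G_s(x) - e^{sΔ}λ(x)| ≤ (1 + ‖λ‖₁) (4πs)^{-3/2}`.
[folklore] -/
theorem abs_heatKernel_sub_heatExtension_le (h₀ : 0 < r₀) (h₁ : r₀ < r₁) {s : ℝ} (hs : 0 < s)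
    (x : ℝ³) :
    |UnboundedOperators.heatKernel s x - UnboundedOperators.heatExtension (newtonFarLaplacian r₀ r₁) s x| ≤
      (1 + (eLpNorm (newtonFarLaplacian r₀ r₁) 1 volume).toReal) * (4 * π * s) ^ (-(3 : ℝ) / 2) := by
  have hfin := (memLp_one_newtonFarLaplacian h₀ h₁).eLpNorm_ne_top
  have hG : |UnboundedOperators.heatKernel s x| ≤ (4 * π * s) ^ (-(3 : ℝ) / 2) := by
    rw [abs_of_nonneg (UnboundedOperators.heatKernel_pos hs x).le]
    have := UnboundedOperators.heatKernel_le hs x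
    rwa [finrank_R3', show (-((3 : ℕ) : ℝ) / 2 : ℝ) = -(3 : ℝ) / 2 by norm_num] at this
  have hE : |UnboundedOperators.heatExtension (newtonFarLaplacian r₀ r₁) s x| ≤
      (4 * π * s) ^ (-(3 : ℝ) / 2) * (eLpNorm (newtonFarLaplacian r₀ r₁) 1 volume).toReal := by
    have h := UnboundedOperators.enorm_heatExtension_le (memLp_one_newtonFarLaplacian h₀ h₁) le_rfl hs x
    rw [finrank_R3', inv_one, ENNReal.toReal_one, ENNReal.rpow_one,
      show (-((3 : ℕ) : ℝ) / 2 : ℝ) = -(3 : ℝ) / 2 by norm_num] at h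
    rw [← Real.norm_eq_abs, ← toReal_enorm]
    calc (‖UnboundedOperators.heatExtension (newtonFarLaplacian r₀ r₁) s x‖ₑ).toReal
        ≤ (ENNReal.ofReal ((4 * π * s) ^ (-(3 : ℝ) / 2)) *
            eLpNorm (newtonFarLaplacian r₀ r₁) 1 volume).toReal :=
          ENNReal.toReal_mono (ENNReal.mul_ne_top ENNReal.ofReal_ne_top hfin) h
      _ = (4 * π * s) ^ (-(3 : ℝ) / 2) * (eLpNorm (newtonFarLaplacian r₀ r₁) 1 volume).toReal := by
          rw [ENNReal.toReal_mul, ENNReal.toReal_ofReal (by positivity)]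
  calc |UnboundedOperators.heatKernel s x - UnboundedOperators.heatExtension (newtonFarLaplacian r₀ r₁) s x|
      ≤ |UnboundedOperators.heatKernel s x| +
          |UnboundedOperators.heatExtension (newtonFarLaplacian r₀ r₁) s x| := abs_sub _ _
    _ ≤ (4 * π * s) ^ (-(3 : ℝ) / 2) +
          (4 * π * s) ^ (-(3 : ℝ) / 2) * (eLpNorm (newtonFarLaplacian r₀ r₁) 1 volume).toReal :=
        add_le_add hG hE
    _ = (1 + (eLpNorm (newtonFarLaplacian r₀ r₁) 1 volume).toReal) * (4 * π * s) ^ (-(3 : ℝ) / 2) := by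
        ring

/-- `(4πs)^{-3/2} ≤ s^{-3/2}` for `s > 0` (`4π ≥ 1`). [folklore] -/
theorem four_pi_mul_rpow_neg_three_halves_le {s : ℝ} (hs : 0 < s) :
    (4 * π * s) ^ (-(3 : ℝ) / 2) ≤ s ^ (-(3 : ℝ) / 2) := by
  have h4 : (1 : ℝ) ≤ 4 * π := by have := Real.pi_gt_three; linarith
  rw [show (-(3 : ℝ) / 2) = -(3 / 2 : ℝ) by ring, Real.rpow_neg (by positivity), Real.rpow_neg hs.le]
  refine inv_anti₀ (Real.rpow_pos_of_pos hs _) ?_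
  exact Real.rpow_le_rpow hs.le (by nlinarith) (by norm_num)

/-- The time integrand is integrable on `(b, ∞)` for `b > 0`. [folklore] -/
theorem integrableOn_heatKernel_sub_heatExtension (h₀ : 0 < r₀) (h₁ : r₀ < r₁) {b : ℝ} (hb : 0 < b)
    (x : ℝ³) :
    IntegrableOn (fun s => UnboundedOperators.heatKernel s x -
      UnboundedOperators.heatExtension (newtonFarLaplacian r₀ r₁) s x) (Ioi b) volume := by
  set C : ℝ := 1 + (eLpNorm (newtonFarLaplacian r₀ r₁) 1 volume).toReal with hC
  have hmeas : AEStronglyMeasurable (fun s => UnboundedOperators.heatKernel s x -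
      UnboundedOperators.heatExtension (newtonFarLaplacian r₀ r₁) s x) (volume.restrict (Ioi b)) :=
    ((continuousOn_heatKernel_sub_heatExtension h₀ h₁ x).mono (Ioi_subset_Ioi hb.le)).aestronglyMeasurable
      measurableSet_Ioi
  refine ((integrableOn_Ioi_rpow_of_lt (by norm_num : (-(3 : ℝ) / 2) < -1) hb).const_mul C).mono' hmeas ?_
  refine (ae_restrict_iff' measurableSet_Ioi).2 (Eventually.of_forall fun s hs => ?_)
  have hs0 : 0 < s := hb.trans hs
  rw [Real.norm_eq_abs]
  exact (abs_heatKernel_sub_heatExtension_le h₀ h₁ hs0 x).trans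
    (mul_le_mul_of_nonneg_left (four_pi_mul_rpow_neg_three_halves_le hs0) (by positivity))

/-- `e^{sΔ}Γ₀(x) → 0` as `s → ∞`. [folklore] -/
theorem tendsto_heatExtension_newtonNear_atTop (h₀ : 0 < r₀) (h₁ : r₀ < r₁) (x : ℝ³) :
    Tendsto (fun s => UnboundedOperators.heatExtension (newtonNear r₀ r₁) s x) atTop (𝓝 0) := by
  have h := UnboundedOperators.tendsto_enorm_heatExtension_atTop (memLp_one_newtonNear h₀ h₁) le_rfl
    ENNReal.one_ne_top (by rw [finrank_R3']; norm_num) x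
  rw [tendsto_zero_iff_norm_tendsto_zero]
  have h2 := (ENNReal.tendsto_toReal ENNReal.zero_ne_top).comp h
  rw [ENNReal.toReal_zero] at h2
  refine h2.congr fun σ => ?_
  show (‖UnboundedOperators.heatExtension (newtonNear r₀ r₁) σ x‖ₑ).toReal = _
  exact toReal_enorm _

/-- **Duhamel representation of the heat flow of the truncated Newtonian kernel**: for
`0 < r₀ < r₁`, `b > 0` and every `x ∈ ℝ³`,
`e^{bΔ}Γ₀(x) = -∫_b^∞ (G_s(x) - e^{sΔ}λ(x)) ds` (`Γ₀ = θΓ`, `λ = Δ((1-θ)Γ)`): the function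
`s ↦ e^{sΔ}Γ₀(x)` has derivative `Δe^{sΔ}Γ₀(x) = G_s(x) - e^{sΔ}λ(x)` and tends to `0` at
infinity (fundamental theorem of calculus on `(b, ∞)`). This is the localised form of
`Δ⁻¹G_b = -∫_b^∞ G_s ds` (Koch–Tataru 2001, §2, (5)–(8)). [folklore] -/
theorem heatExtension_newtonNear_eq_neg_integral_Ioi (h₀ : 0 < r₀) (h₁ : r₀ < r₁) {b : ℝ}
    (hb : 0 < b) (x : ℝ³) :
    UnboundedOperators.heatExtension (newtonNear r₀ r₁) b x =
      -∫ s in Ioi b, (UnboundedOperators.heatKernel s x -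
        UnboundedOperators.heatExtension (newtonFarLaplacian r₀ r₁) s x) := by
  have hderiv : ∀ s ∈ Ioi (b / 2), HasDerivAt (fun σ => UnboundedOperators.heatExtension (newtonNear r₀ r₁) σ x)
      (UnboundedOperators.heatKernel s x - UnboundedOperators.heatExtension (newtonFarLaplacian r₀ r₁) s x) s := by
    intro s hs
    have hs0 : 0 < s := by have : b / 2 < s := hs; linarith
    have h := UnboundedOperators.hasDerivAt_heatExtension_time hs0 (memLp_one_newtonNear h₀ h₁) le_rfl x
    rwa [laplacian_heatExtension_newtonNear h₀ h₁ hs0 x] at h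
  have hcont : ContinuousWithinAt (fun σ => UnboundedOperators.heatExtension (newtonNear r₀ r₁) σ x) (Ici b) b :=
    (hderiv b (by rw [mem_Ioi]; linarith)).continuousAt.continuousWithinAt
  have h := integral_Ioi_of_hasDerivAt_of_tendsto hcont (fun s hs => hderiv s (by
      rw [mem_Ioi] at hs ⊢; linarith)) (integrableOn_heatKernel_sub_heatExtension h₀ h₁ hb x)
    (tendsto_heatExtension_newtonNear_atTop h₀ h₁ x)
  rw [h]; ring

/-- The family `s ↦ -(G_s - e^{sΔ}λ)` on `(b, ∞)`, `b > 0`, is dominated by `C s^{-3/2}`.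
[folklore] -/
theorem isDominatedFamily_heatKernel_sub_heatExtension (h₀ : 0 < r₀) (h₁ : r₀ < r₁) {b : ℝ}
    (hb : 0 < b) :
    IsDominatedFamily (E := ℝ³) (Ioi b)
      (fun s y => -(UnboundedOperators.heatKernel s y -
        UnboundedOperators.heatExtension (newtonFarLaplacian r₀ r₁) s y))
      (fun s => (1 + (eLpNorm (newtonFarLaplacian r₀ r₁) 1 volume).toReal) * s ^ (-(3 : ℝ) / 2)) where
  measurableSet := measurableSet_Ioi
  aestronglyMeasurable := by
    refine aestronglyMeasurable_uncurry_restrict_of_continuousOn measurableSet_Ioi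
      (Ioi_subset_Ioi hb.le) ?_
    exact (UnboundedOperators.continuousOn_uncurry_heatKernel'.sub
      (UnboundedOperators.continuousOn_uncurry_heatExtension_of_memLp
        (memLp_one_newtonFarLaplacian h₀ h₁) le_rfl)).neg
  slice s hs := by
    have hs0 : 0 < s := hb.trans hs
    exact ((UnboundedOperators.continuous_heatKernel s).sub
      ((UnboundedOperators.contDiff_heatExtension_holds (memLp_one_newtonFarLaplacian h₀ h₁) le_rfl
        hs0).continuous)).neg.aestronglyMeasurable
  bound s hs y := by
    have hs0 : 0 < s := hb.trans hs
    rw [abs_neg]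
    exact (abs_heatKernel_sub_heatExtension_le h₀ h₁ hs0 y).trans
      (mul_le_mul_of_nonneg_left (four_pi_mul_rpow_neg_three_halves_le hs0) (by positivity))
  integrable := (integrableOn_Ioi_rpow_of_lt (by norm_num : (-(3 : ℝ) / 2) < -1) hb).const_mul _

/-- **Duhamel representation of the third derivatives**: for `0 < r₀ < r₁`, `a > 0`, `x ∈ ℝ³`,
`heatD3 a u v w Γ₀ (x) = -∫_a^∞ (D³G_s(x)[u, v, w] - heatD3 s u v w λ (x)) ds`
(apply `heatD3 (a/2)` to the representation of `e^{(a/2)Δ}Γ₀`, pass it under the time integral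
by `heatD3_setIntegral_comm`, and use `heatD3 (a/2) G_s = D³G_{s+a/2}`,
`heatD3 (a/2) (e^{sΔ}λ) = heatD3 (s + a/2) λ`). [folklore] -/
theorem heatD3_newtonNear_eq_neg_integral_Ioi (h₀ : 0 < r₀) (h₁ : r₀ < r₁) {a : ℝ} (ha : 0 < a)
    (u v w x : ℝ³) :
    heatD3 a u v w (newtonNear r₀ r₁) x =
      -∫ s in Ioi a, (iteratedFDeriv ℝ 3 (UnboundedOperators.heatKernel s) x ![u, v, w] -
        heatD3 s u v w (newtonFarLaplacian r₀ r₁) x) := by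
  set b : ℝ := a / 2 with hb_def
  have hb : 0 < b := by positivity
  have hΓ := memLp_one_newtonNear h₀ h₁
  have hlam1 := memLp_one_newtonFarLaplacian h₀ h₁
  -- `heatD3 a Γ₀ = heatD3 b (e^{bΔ}Γ₀)`
  have step1 : heatD3 a u v w (newtonNear r₀ r₁) x =
      heatD3 b u v w (UnboundedOperators.heatExtension (newtonNear r₀ r₁) b) x := by
    rw [heatD3_heatExtension hΓ le_rfl hb hb, show b + b = a by rw [hb_def]; ring]
  -- the representation of `e^{bΔ}Γ₀` as an integral of the dominated family
  have hfam := isDominatedFamily_heatKernel_sub_heatExtension h₀ h₁ hb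
  have step2 : UnboundedOperators.heatExtension (newtonNear r₀ r₁) b =
      fun y => ∫ s in Ioi b, -(UnboundedOperators.heatKernel s y -
        UnboundedOperators.heatExtension (newtonFarLaplacian r₀ r₁) s y) := by
    funext y
    rw [heatExtension_newtonNear_eq_neg_integral_Ioi h₀ h₁ hb y, ← integral_neg]
  rw [step1, step2, heatD3_setIntegral_comm hfam hb u v w x]
  -- evaluate `heatD3 b` on each member of the family
  have step3 : ∀ s ∈ Ioi b, heatD3 b u v w (fun y => -(UnboundedOperators.heatKernel s y -
      UnboundedOperators.heatExtension (newtonFarLaplacian r₀ r₁) s y)) x =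
      -(iteratedFDeriv ℝ 3 (UnboundedOperators.heatKernel (s + b)) x ![u, v, w] -
        heatD3 (s + b) u v w (newtonFarLaplacian r₀ r₁) x) := by
    intro s hs
    have hs0 : 0 < s := hb.trans hs
    have hGs : MemLp (UnboundedOperators.heatKernel (E := ℝ³) s) 1 volume :=
      (memLp_one_iff_integrable).2 (UnboundedOperators.integrable_heatKernel_holds hs0)
    have hEs : MemLp (UnboundedOperators.heatExtension (newtonFarLaplacian r₀ r₁) s) 1 volume :=
      UnboundedOperators.memLp_heatExtension_holds hlam1 le_rfl hs0
    have hneg : (fun y => -(UnboundedOperators.heatKernel s y -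
        UnboundedOperators.heatExtension (newtonFarLaplacian r₀ r₁) s y)) =
        UnboundedOperators.heatExtension (newtonFarLaplacian r₀ r₁) s -
          UnboundedOperators.heatKernel s := by
      funext y; rw [Pi.sub_apply]; ring
    rw [hneg, heatD3_sub hEs hGs le_rfl hb u v w x, heatD3_heatExtension hlam1 le_rfl hs0 hb,
      heatD3_heatKernel hs0 hb, add_comm b s]
    ring
  rw [setIntegral_congr_fun measurableSet_Ioi step3, integral_neg]
  -- shift the time variable `s ↦ s - b`
  congr 1
  have hshift := setIntegral_Ioi_comp_add_right
    (fun s => iteratedFDeriv ℝ 3 (UnboundedOperators.heatKernel s) x ![u, v, w] -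
      heatD3 s u v w (newtonFarLaplacian r₀ r₁) x) b b
  rw [show b + b = a by rw [hb_def]; ring] at hshift
  exact hshift

/-! ### The `L¹` bound -/

/-- **The time integral of `D³G_s` through the Oseen–Koch–Tataru kernel**:
`∫_a^∞ D³G_s(x)[u, v, w] ds = ⟪K(a, x)[u, w], v⟫ - ∂ᵤG_a(x) ⟪w, v⟫` (`inner_oseenKernel_eq`).
[cite: KochTataruAdvMath2001, §2 (5)–(8)] -/
theorem integral_Ioi_iteratedFDeriv_three_heatKernel {a : ℝ} (ha : 0 < a) (u v w x : ℝ³) :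
    ∫ s in Ioi a, iteratedFDeriv ℝ 3 (UnboundedOperators.heatKernel s) x ![u, v, w] =
      ⟪oseenKernel a x u w, v⟫ - fderiv ℝ (UnboundedOperators.heatKernel a) x u * ⟪w, v⟫ := by
  rw [inner_oseenKernel_eq ha x u w v]; ring

/-- The `L¹` norm of `x ↦ ∫_a^∞ D³G_s(x)[u, v, w] ds` is `O(a^{-1/2})` for `‖u‖, ‖v‖, ‖w‖ ≤ 1`.
[cite: KochTataruAdvMath2001, §3 (14)] -/
theorem exists_lintegral_enorm_integral_Ioi_iteratedFDeriv_three_le :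
    ∃ C : ℝ, 0 < C ∧ ∀ {a : ℝ}, 0 < a → ∀ u v w : ℝ³, ‖u‖ ≤ 1 → ‖v‖ ≤ 1 → ‖w‖ ≤ 1 →
      ∫⁻ x, ‖∫ s in Ioi a, iteratedFDeriv ℝ 3 (UnboundedOperators.heatKernel s) x ![u, v, w]‖ₑ ≤
        ENNReal.ofReal (C * a ^ (-(1 / 2 : ℝ))) := by
  obtain ⟨C, hC, hK⟩ := exists_lintegral_enorm_oseenKernel_le (E := ℝ³)
  refine ⟨C + (2 : ℝ) ^ ((3 : ℝ) / 2), by positivity, fun {a} ha u v w hu hv hw => ?_⟩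
  have hpt : ∀ x : ℝ³, ‖∫ s in Ioi a, iteratedFDeriv ℝ 3 (UnboundedOperators.heatKernel s) x ![u, v, w]‖ₑ ≤
      ‖oseenKernel a x u w‖ₑ + ‖fderiv ℝ (UnboundedOperators.heatKernel a) x u‖ₑ := by
    intro x
    rw [integral_Ioi_iteratedFDeriv_three_heatKernel ha]
    calc ‖⟪oseenKernel a x u w, v⟫ - fderiv ℝ (UnboundedOperators.heatKernel a) x u * ⟪w, v⟫‖ₑ
        ≤ ‖(⟪oseenKernel a x u w, v⟫ : ℝ)‖ₑ + ‖fderiv ℝ (UnboundedOperators.heatKernel a) x u * ⟪w, v⟫‖ₑ :=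
          enorm_sub_le
      _ ≤ ‖oseenKernel a x u w‖ₑ + ‖fderiv ℝ (UnboundedOperators.heatKernel a) x u‖ₑ := by
          gcongr
          · rw [← ofReal_norm, ← ofReal_norm]
            refine ENNReal.ofReal_le_ofReal ?_
            calc ‖(⟪oseenKernel a x u w, v⟫ : ℝ)‖ ≤ ‖oseenKernel a x u w‖ * ‖v‖ := norm_inner_le_norm _ _
              _ ≤ ‖oseenKernel a x u w‖ * 1 := by gcongr
              _ = ‖oseenKernel a x u w‖ := mul_one _
          · rw [← ofReal_norm, ← ofReal_norm]
            refine ENNReal.ofReal_le_ofReal ?_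
            rw [norm_mul]
            calc ‖fderiv ℝ (UnboundedOperators.heatKernel a) x u‖ * ‖(⟪w, v⟫ : ℝ)‖
                ≤ ‖fderiv ℝ (UnboundedOperators.heatKernel a) x u‖ * (‖w‖ * ‖v‖) := by
                  gcongr; exact norm_inner_le_norm _ _
              _ ≤ ‖fderiv ℝ (UnboundedOperators.heatKernel a) x u‖ * (1 * 1) := by gcongr
              _ = ‖fderiv ℝ (UnboundedOperators.heatKernel a) x u‖ := by ring
  calc ∫⁻ x, ‖∫ s in Ioi a, iteratedFDeriv ℝ 3 (UnboundedOperators.heatKernel s) x ![u, v, w]‖ₑ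
      ≤ ∫⁻ x, (‖oseenKernel a x u w‖ₑ + ‖fderiv ℝ (UnboundedOperators.heatKernel a) x u‖ₑ) :=
        lintegral_mono hpt
    _ = (∫⁻ x, ‖oseenKernel a x u w‖ₑ) + ∫⁻ x, ‖fderiv ℝ (UnboundedOperators.heatKernel a) x u‖ₑ :=
        lintegral_add_left ((measurable_oseenKernel_left a u w).enorm) _
    _ ≤ ENNReal.ofReal (C * a ^ (-(1 / 2 : ℝ))) * ‖u‖ₑ * ‖w‖ₑ +
          ENNReal.ofReal ((2 : ℝ) ^ ((Module.finrank ℝ ℝ³ : ℝ) / 2) * a ^ (-(1 / 2 : ℝ)) * ‖u‖) :=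
        add_le_add (hK ha u w).2 (UnboundedOperators.lintegral_enorm_fderiv_heatKernel_apply_le ha u)
    _ ≤ ENNReal.ofReal (C * a ^ (-(1 / 2 : ℝ))) + ENNReal.ofReal ((2 : ℝ) ^ ((3 : ℝ) / 2) * a ^ (-(1 / 2 : ℝ))) := by
        refine add_le_add ?_ ?_
        · calc ENNReal.ofReal (C * a ^ (-(1 / 2 : ℝ))) * ‖u‖ₑ * ‖w‖ₑ
              ≤ ENNReal.ofReal (C * a ^ (-(1 / 2 : ℝ))) * 1 * 1 := by
                refine mul_le_mul' (mul_le_mul' le_rfl ?_) ?_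
                · rw [← ofReal_norm]; exact ENNReal.ofReal_le_one.2 hu
                · rw [← ofReal_norm]; exact ENNReal.ofReal_le_one.2 hw
            _ = ENNReal.ofReal (C * a ^ (-(1 / 2 : ℝ))) := by ring
        · refine ENNReal.ofReal_le_ofReal ?_
          rw [finrank_R3']
          have h0 : 0 ≤ (2 : ℝ) ^ ((3 : ℝ) / 2) * a ^ (-(1 / 2 : ℝ)) := by positivity
          calc (2 : ℝ) ^ (((3 : ℕ) : ℝ) / 2) * a ^ (-(1 / 2 : ℝ)) * ‖u‖
              = (2 : ℝ) ^ ((3 : ℝ) / 2) * a ^ (-(1 / 2 : ℝ)) * ‖u‖ := by norm_num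
            _ ≤ (2 : ℝ) ^ ((3 : ℝ) / 2) * a ^ (-(1 / 2 : ℝ)) * 1 :=
                mul_le_mul_of_nonneg_left hu h0
            _ = _ := mul_one _
    _ = ENNReal.ofReal ((C + (2 : ℝ) ^ ((3 : ℝ) / 2)) * a ^ (-(1 / 2 : ℝ))) := by
        rw [← ENNReal.ofReal_add (by positivity) (by positivity)]; ring_nf

/-- **Uniform bound for the `λ` part**: for `0 < r₀ < r₁` there is `C` with
`∫_a^∞ ‖heatD3 s u v w λ‖₁ ds ≤ C` for all `a > 0` and `‖u‖, ‖v‖, ‖w‖ ≤ 1` — near `s = 0` by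
`‖heatD3 s u v w λ‖₁ ≤ ‖∂ᵤ∂ᵥ∂_wλ‖₁` (derivatives on `λ`), for `s ≥ 1` by
`‖heatD3 s u v w λ‖₁ ≤ 216 s^{-3/2} ‖λ‖₁`. [folklore] -/
theorem exists_lintegral_Ioi_eLpNorm_heatD3_newtonFarLaplacian_le (h₀ : 0 < r₀) (h₁ : r₀ < r₁)
    (u v w : ℝ³) (hu : ‖u‖ ≤ 1) (hv : ‖v‖ ≤ 1) (hw : ‖w‖ ≤ 1) :
    ∃ C : ℝ, 0 ≤ C ∧ ∀ {a : ℝ}, 0 < a →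
      ∫⁻ s in Ioi a, eLpNorm (heatD3 s u v w (newtonFarLaplacian r₀ r₁)) 1 volume ≤ ENNReal.ofReal C := by
  set lam := newtonFarLaplacian r₀ r₁ with hlam
  have hlam1 := memLp_one_newtonFarLaplacian h₀ h₁
  have hlamC := contDiff_newtonFarLaplacian h₀ h₁ (n := ⊤)
  have hlamc := hasCompactSupport_newtonFarLaplacian h₀.le h₁
  set A : ℝ≥0∞ := eLpNorm (fun y => fderiv ℝ (fun z => fderiv ℝ (fun z' => fderiv ℝ lam z' w) z v) y u)
    1 volume with hA
  have hAfin : A ≠ ∞ := by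
    obtain ⟨hg₁, hg₁c⟩ := contDiff_hasCompactSupport_fderiv_apply hlamC hlamc w
    obtain ⟨hg₂, hg₂c⟩ := contDiff_hasCompactSupport_fderiv_apply hg₁ hg₁c v
    obtain ⟨hg₃, hg₃c⟩ := contDiff_hasCompactSupport_fderiv_apply hg₂ hg₂c u
    exact (memLp_one_of_contDiff_hasCompactSupport hg₃ hg₃c).eLpNorm_ne_top
  set B : ℝ≥0∞ := eLpNorm lam 1 volume with hB
  have hBfin : B ≠ ∞ := hlam1.eLpNorm_ne_top
  refine ⟨A.toReal + 2 * 216 * B.toReal, by positivity, fun {a} ha => ?_⟩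
  -- pointwise bound by the sum of the two regimes
  have hpt : ∀ s ∈ Ioi a, eLpNorm (heatD3 s u v w lam) 1 volume ≤
      (Iic (1 : ℝ)).indicator (fun _ => A) s +
        (Ioi (1 : ℝ)).indicator (fun s => ENNReal.ofReal (216 * s ^ (-(3 / 2) : ℝ)) * B) s := by
    intro s hs
    have hs0 : 0 < s := ha.trans hs
    by_cases h1 : s ≤ 1
    · rw [indicator_of_mem (show s ∈ Iic (1 : ℝ) from h1), indicator_of_notMem (show s ∉ Ioi (1 : ℝ) from not_lt.2 h1), add_zero]
      exact eLpNorm_heatD3_le_of_contDiff hlamC hlamc hs0 u v w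
    · push Not at h1
      rw [indicator_of_notMem (show s ∉ Iic (1 : ℝ) from not_le.2 h1), indicator_of_mem (show s ∈ Ioi (1 : ℝ) from h1), zero_add]
      exact eLpNorm_heatD3_le_dim3 finrank_R3' hlam1 le_rfl hs0 hu hv hw
  calc ∫⁻ s in Ioi a, eLpNorm (heatD3 s u v w lam) 1 volume
      ≤ ∫⁻ s in Ioi a, ((Iic (1 : ℝ)).indicator (fun _ => A) s +
          (Ioi (1 : ℝ)).indicator (fun s => ENNReal.ofReal (216 * s ^ (-(3 / 2) : ℝ)) * B) s) :=
        setLIntegral_mono' measurableSet_Ioi hpt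
    _ ≤ ∫⁻ s, ((Iic (1 : ℝ) ∩ Ioi 0).indicator (fun _ => A) s +
          (Ioi (1 : ℝ)).indicator (fun s => ENNReal.ofReal (216 * s ^ (-(3 / 2) : ℝ)) * B) s) := by
        rw [← lintegral_indicator measurableSet_Ioi]
        refine lintegral_mono fun s => ?_
        by_cases hs : s ∈ Ioi a
        · rw [indicator_of_mem hs]
          have hs0 : s ∈ Ioi (0 : ℝ) := ha.trans hs
          have heq : (Iic (1 : ℝ)).indicator (fun _ => A) s =
              (Iic (1 : ℝ) ∩ Ioi 0).indicator (fun _ => A) s := by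
            by_cases h1 : s ∈ Iic (1 : ℝ)
            · rw [indicator_of_mem h1, indicator_of_mem (show s ∈ Iic (1 : ℝ) ∩ Ioi 0 from ⟨h1, hs0⟩)]
            · rw [indicator_of_notMem h1,
                indicator_of_notMem (show s ∉ Iic (1 : ℝ) ∩ Ioi 0 from fun h => h1 h.1)]
          rw [heq]
        · rw [indicator_of_notMem hs]; exact zero_le
    _ = (∫⁻ s, (Iic (1 : ℝ) ∩ Ioi 0).indicator (fun _ => A) s) +
          ∫⁻ s, (Ioi (1 : ℝ)).indicator (fun s => ENNReal.ofReal (216 * s ^ (-(3 / 2) : ℝ)) * B) s :=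
        lintegral_add_left ((measurable_const.indicator (measurableSet_Iic.inter measurableSet_Ioi))) _
    _ ≤ A + ENNReal.ofReal (2 * 216) * B := by
        refine add_le_add ?_ ?_
        · rw [lintegral_indicator (measurableSet_Iic.inter measurableSet_Ioi), setLIntegral_const]
          calc A * volume (Iic (1 : ℝ) ∩ Ioi 0) ≤ A * 1 := by
                refine mul_le_mul' le_rfl ?_
                rw [show Iic (1 : ℝ) ∩ Ioi 0 = Ioc 0 1 by ext s; simp [and_comm], Real.volume_Ioc]
                simp
            _ = A := mul_one A
        · rw [lintegral_indicator measurableSet_Ioi]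
          have hI : ∫⁻ s in Ioi (1 : ℝ), ENNReal.ofReal (216 * s ^ (-(3 / 2) : ℝ)) * B =
              ENNReal.ofReal (2 * 216) * B := by
            rw [lintegral_mul_const _ (by fun_prop)]
            congr 1
            have h2 : ∀ s : ℝ, ENNReal.ofReal (216 * s ^ (-(3 / 2) : ℝ)) =
                ENNReal.ofReal 216 * ENNReal.ofReal (s ^ (-(3 / 2) : ℝ)) := fun s =>
              ENNReal.ofReal_mul (by norm_num)
            simp_rw [h2]
            rw [lintegral_const_mul _ (by fun_prop),
              UnboundedOperators.lintegral_Ioi_rpow (by norm_num : (-(3 / 2) : ℝ) < -1) one_pos,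
              Real.one_rpow, ← ENNReal.ofReal_mul (by norm_num)]
            congr 1; norm_num
          rw [hI]
    _ = ENNReal.ofReal (A.toReal + 2 * 216 * B.toReal) := by
        rw [ENNReal.ofReal_add (by positivity) (by positivity), ENNReal.ofReal_toReal hAfin,
          ENNReal.ofReal_mul (by norm_num : (0 : ℝ) ≤ 2 * 216), ENNReal.ofReal_toReal hBfin]

/-- Joint measurability of `(s, x) ↦ heatD3 s u v w λ x` on `(a, ∞) × ℝ³`. [folklore] -/
theorem aestronglyMeasurable_heatD3_newtonFarLaplacian (h₀ : 0 < r₀) (h₁ : r₀ < r₁) {a : ℝ}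
    (ha : 0 < a) (u v w : ℝ³) :
    AEStronglyMeasurable (uncurry fun s x => heatD3 s u v w (newtonFarLaplacian r₀ r₁) x)
      ((volume.restrict (Ioi a)).prod (volume : Measure ℝ³)) :=
  aestronglyMeasurable_uncurry_restrict_of_continuousOn measurableSet_Ioi (Ioi_subset_Ioi ha.le)
    (continuousOn_uncurry_heatD3 (memLp_one_newtonFarLaplacian h₀ h₁) u v w)

/-- **The `L¹` bound for the third derivatives of `e^{aΔ}Γ₀`**: for `0 < r₀ < r₁` and
`‖u‖, ‖v‖, ‖w‖ ≤ 1` there is `C` with `∫ |heatD3 a u v w Γ₀| ≤ C (1 + a^{-1/2})` for all `a > 0`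
(Koch–Tataru 2001, (14), for the Gaussian part; the smoothing remainder `λ` contributes a
bounded amount). [cite: KochTataruAdvMath2001, §3 (14)] -/
theorem exists_lintegral_enorm_heatD3_newtonNear_le (h₀ : 0 < r₀) (h₁ : r₀ < r₁) (u v w : ℝ³)
    (hu : ‖u‖ ≤ 1) (hv : ‖v‖ ≤ 1) (hw : ‖w‖ ≤ 1) :
    ∃ C : ℝ, 0 < C ∧ ∀ {a : ℝ}, 0 < a →
      ∫⁻ x, ‖heatD3 a u v w (newtonNear r₀ r₁) x‖ₑ ≤ ENNReal.ofReal (C * (1 + a ^ (-(1 / 2 : ℝ)))) := by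
  obtain ⟨C₁, hC₁, hG⟩ := exists_lintegral_enorm_integral_Ioi_iteratedFDeriv_three_le
  obtain ⟨C₂, hC₂, hL⟩ := exists_lintegral_Ioi_eLpNorm_heatD3_newtonFarLaplacian_le h₀ h₁ u v w hu hv hw
  refine ⟨C₁ + C₂ + 1, by positivity, fun {a} ha => ?_⟩
  set lam := newtonFarLaplacian r₀ r₁ with hlam
  have hlam1 := memLp_one_newtonFarLaplacian h₀ h₁
  -- the `λ` time integrand is integrable on `(a, ∞) × ℝ³`
  have hLmeas := aestronglyMeasurable_heatD3_newtonFarLaplacian h₀ h₁ ha u v w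
  have hLint : Integrable (uncurry fun s x => heatD3 s u v w lam x)
      ((volume.restrict (Ioi a)).prod (volume : Measure ℝ³)) := by
    refine ⟨hLmeas, ?_⟩
    rw [hasFiniteIntegral_iff_enorm, lintegral_prod _ hLmeas.aemeasurable.enorm]
    calc ∫⁻ s in Ioi a, ∫⁻ x, ‖uncurry (fun s x => heatD3 s u v w lam x) (s, x)‖ₑ
        = ∫⁻ s in Ioi a, eLpNorm (heatD3 s u v w lam) 1 volume := by
          refine lintegral_congr fun s => ?_
          rw [eLpNorm_one_eq_lintegral_enorm]; rfl
      _ ≤ ENNReal.ofReal C₂ := hL ha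
      _ < ∞ := ENNReal.ofReal_lt_top
  -- the Gaussian time integrand is integrable on `(a, ∞) × ℝ³`
  have hGint := integrable_iteratedFDeriv_three_heatKernel_prod (E := ℝ³) ha u w v
  -- hence both are integrable in `s` for a.e. `x`
  have haeG : ∀ᵐ x : ℝ³, Integrable (fun s => iteratedFDeriv ℝ 3 (UnboundedOperators.heatKernel s) x ![u, v, w])
      (volume.restrict (Ioi a)) := hGint.swap.prod_right_ae
  have haeL : ∀ᵐ x : ℝ³, Integrable (fun s => heatD3 s u v w lam x) (volume.restrict (Ioi a)) :=
    hLint.swap.prod_right_ae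
  -- pointwise (a.e.) splitting of the representation
  have hsplit : ∀ᵐ x : ℝ³, ‖heatD3 a u v w (newtonNear r₀ r₁) x‖ₑ ≤
      ‖∫ s in Ioi a, iteratedFDeriv ℝ 3 (UnboundedOperators.heatKernel s) x ![u, v, w]‖ₑ +
        ‖∫ s in Ioi a, heatD3 s u v w lam x‖ₑ := by
    filter_upwards [haeG, haeL] with x hxG hxL
    rw [heatD3_newtonNear_eq_neg_integral_Ioi h₀ h₁ ha, enorm_neg, integral_sub hxG hxL]
    exact enorm_sub_le
  -- the `λ` part, integrated in `x`, by Tonelli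
  have hLx : ∫⁻ x, ‖∫ s in Ioi a, heatD3 s u v w lam x‖ₑ ≤ ENNReal.ofReal C₂ := by
    calc ∫⁻ x, ‖∫ s in Ioi a, heatD3 s u v w lam x‖ₑ
        ≤ ∫⁻ x, ∫⁻ s in Ioi a, ‖heatD3 s u v w lam x‖ₑ :=
          lintegral_mono fun x => enorm_integral_le_lintegral_enorm _
      _ = ∫⁻ s in Ioi a, ∫⁻ x, ‖heatD3 s u v w lam x‖ₑ := by
          rw [lintegral_lintegral_swap]
          exact hLmeas.aemeasurable.enorm.prod_swap
      _ = ∫⁻ s in Ioi a, eLpNorm (heatD3 s u v w lam) 1 volume := by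
          refine lintegral_congr fun s => ?_
          rw [eLpNorm_one_eq_lintegral_enorm]
      _ ≤ ENNReal.ofReal C₂ := hL ha
  have ha0 : 0 ≤ a ^ (-(1 / 2 : ℝ)) := Real.rpow_nonneg ha.le _
  calc ∫⁻ x, ‖heatD3 a u v w (newtonNear r₀ r₁) x‖ₑ
      ≤ ∫⁻ x, (‖∫ s in Ioi a, iteratedFDeriv ℝ 3 (UnboundedOperators.heatKernel s) x ![u, v, w]‖ₑ +
          ‖∫ s in Ioi a, heatD3 s u v w lam x‖ₑ) := lintegral_mono_ae hsplit
    _ = (∫⁻ x, ‖∫ s in Ioi a, iteratedFDeriv ℝ 3 (UnboundedOperators.heatKernel s) x ![u, v, w]‖ₑ) +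
          ∫⁻ x, ‖∫ s in Ioi a, heatD3 s u v w lam x‖ₑ := by
        refine lintegral_add_left' ?_ _
        have hm : AEStronglyMeasurable
            (fun x : ℝ³ => ∫ s in Ioi a, iteratedFDeriv ℝ 3 (UnboundedOperators.heatKernel s) x ![u, v, w])
            volume := hGint.swap.aestronglyMeasurable.integral_prod_right'
        exact hm.aemeasurable.enorm
    _ ≤ ENNReal.ofReal (C₁ * a ^ (-(1 / 2 : ℝ))) + ENNReal.ofReal C₂ :=
        add_le_add (hG ha u v w hu hv hw) hLx
    _ = ENNReal.ofReal (C₁ * a ^ (-(1 / 2 : ℝ)) + C₂) :=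
        (ENNReal.ofReal_add (by positivity) hC₂).symm
    _ ≤ ENNReal.ofReal ((C₁ + C₂ + 1) * (1 + a ^ (-(1 / 2 : ℝ)))) := by
        refine ENNReal.ofReal_le_ofReal ?_
        nlinarith

end Newton

end Literature.Analysis.FluidPDE
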